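import Literature.NumberTheory.EllipticCurves.TwoAdicImageSurjectivityModTwoProofs
import Literature.NumberTheory.GaloisRepresentations.AbsGaloisGroup
import Mathlib.GroupTheory.Perm.Sign
import HarnessLib

/-!
# Route ByReductionTypeAtTwo, crux `OrdKatoHalfAtTwoIso` (stmt-BirchSwinnertonDyer-19573), line
# `steinberg-fibre-at-two` v4: helper W-Δ — when `Δ < 0`, complex conjugation acts on `E[2]` as a
# TRANSPOSITION of the three nonzero `2`-torsion points

HONEST FRAMING (cell bsd-2adic): BSD is not proved by any of this; the crux `OrdKatoHalfAtTwoIso` is NOT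
proved here; nothing is booked. This file is a KERNEL HELPER for the line
`Cruxes/OrdKatoHalfAtTwoIso/Lines/steinberg_fibre_at_two.lean` (device (Δ) of the port map of `stub_port`
and of socket 2's memo MEMO-5′ R1); it is not one of the line's registered stubs.

Setting. `W/ℚ` elliptic; `E[2] ∖ 0 = {T₀, T₁, T₂}` (tree `DokchitserDokchitser2012.T`), `x_i = x(T_i)`,
`δ = (x₀ - x₁)(x₀ - x₂)(x₁ - x₂) ∈ ℚ̄` (tree `DokchitserDokchitser2012.delta`, `δ ≠ 0`, `Δ = 16 δ²` —
`algebraMap_Δ`, Silverman *AEC* III.§1 — and `σ δ = sign(permGal σ) · δ` — `smul_delta`, "`ℚ(E[2]) ⊃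
ℚ(√Δ)`", Dokchitser–Dokchitser 2012, proof of Theorem (1)); `permGal W _ σ ∈ S₃` is the permutation of
the letters induced by `σ ∈ Γ_ℚ` (`σ T_i = T_{permGal σ i}`). A complex conjugation `c ∈ Γ_ℚ` for the
real embedding `φ : ℚ → ℝ` (tree `IsComplexConjugation φ c`: some `ι : ℚ̄ →+* ℂ` over `φ` has
`ι (c • x) = conj (ι x)`).

Contents (all sorry-free, no named fact, no instance):

* `smul_delta_eq_neg_of_isComplexConjugation_of_Δ_neg` — if `Δ < 0` then `c • δ = -δ`: `(ι δ)² = Δ/16`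
  is a negative real number, so `ι δ` is purely imaginary, `conj (ι δ) = -ι δ`, i.e. `ι (c • δ) = ι (-δ)`,
  and `ι` is injective.
* `sign_permGal_eq_neg_one_of_isComplexConjugation_of_Δ_neg` — hence `c` is ODD on `{T₀, T₁, T₂}`
  (`c • δ = sign · δ` with `δ ≠ 0` in characteristic `0`), i.e. a transposition: `√Δ ∉ ℝ` is moved by `c`.
* `exists_smul_ne_of_isComplexConjugation_of_Δ_neg` — in particular `c` moves some point of `E[2]`.

References: J. H. Silverman, *The Arithmetic of Elliptic Curves*, 2nd ed., GTM 106 (2009), III.§1 (the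
`2`-division cubic, `Δ = 16 · disc`), III.§7 [SilvermanAEC2009]; T. Dokchitser, V. Dokchitser, Math. Z. 272
(2012) 961–964, Theorem (1) and its proof ("`ℚ(E[2]) ⊃ ℚ(√Δ)`") [DokchitserDokchitserMathZ2012].
-/

set_option autoImplicit false
set_option linter.dupNamespace false

noncomputable section

open WeierstrassCurve
open Literature.NumberTheory.EllipticCurves.DokchitserDokchitser2012 Literature.NumberTheory.GaloisRepresentations

-- D-0017: single-problem summit, so `Summit.BirchSwinnertonDyer.BirchSwinnertonDyer.…` repeats a namespace BY DESIGN.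
namespace Summit.BirchSwinnertonDyer.BirchSwinnertonDyer.Theorems.SteinbergFibreAtTwo

/-- A complex number whose square is a negative rational is purely imaginary: `conj z = -z`
(`z = a + bi`, `z² = a² - b² + 2ab·i`; `2ab = 0` and `a² - b² < 0` force `a = 0`). [folklore] -/
private theorem conj_eq_neg_of_sq_eq_ratCast_of_neg {z : ℂ} {q : ℚ} (hz : z ^ 2 = (q : ℂ))
    (hq : q < 0) : starRingEnd ℂ z = -z := by
  have hre : z.re * z.re - z.im * z.im = q := by
    have h := congrArg Complex.re hz
    rwa [pow_two, Complex.mul_re, Complex.ratCast_re] at h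
  have him : z.re * z.im + z.im * z.re = 0 := by
    have h := congrArg Complex.im hz
    rwa [pow_two, Complex.mul_im, Complex.ratCast_im] at h
  have hri : z.re * z.im = 0 := by linear_combination him / 2
  have hq' : (q : ℝ) < 0 := by exact_mod_cast hq
  rcases mul_eq_zero.mp hri with h0 | h0
  · exact Complex.ext (by simp [h0]) (by simp)
  · exfalso
    rw [h0, mul_zero, sub_zero] at hre
    nlinarith [mul_self_nonneg z.re]

/-- **Helper W-Δ, first form: complex conjugation negates `δ = √(Δ/16)` when `Δ < 0`.** For an
elliptic `W/ℚ` with `Δ < 0` and a complex conjugation `c ∈ Γ_ℚ` (for the real embedding `φ`, with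
`ι : ℚ̄ →+* ℂ`, `ι (c • x) = conj (ι x)`): `c • δ = -δ`. Proof: `ι(Δ) = Δ ∈ ℚ ⊂ ℂ` (a ring map
`ℚ → ℂ` is the cast) and `Δ = 16 δ²` in `ℚ̄` (Silverman III.§1: the `2`-division cubic has discriminant
`16Δ` and roots `x₀, x₁, x₂`), so `(ι δ)² = Δ/16 < 0`; hence `ι δ ∈ iℝ`, `conj (ι δ) = -ι δ`, i.e.
`ι (c • δ) = ι (-δ)`, and `ι` is injective. [cite: SilvermanAEC2009, III.§1] -/
theorem smul_delta_eq_neg_of_isComplexConjugation_of_Δ_neg (W : WeierstrassCurve ℚ) [W.IsElliptic]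
    {φ : ℚ →+* ℝ} {c : Field.absoluteGaloisGroup ℚ} (hc : IsComplexConjugation φ c) (hΔ : W.Δ < 0) :
    c • delta W two_ne_zero = - delta W two_ne_zero := by
  obtain ⟨ι, -, hι⟩ := isComplexConjugation_iff.mp hc
  -- `Δ = 16 δ²` under `ι`; `ι Δ = Δ` (ring maps `ℚ → ℚ̄ → ℂ` are the rational casts)
  have h16 : (16 : ℂ) * ι (delta W two_ne_zero) ^ 2 = (W.Δ : ℂ) := by
    have h := congrArg ι (algebraMap_Δ W two_ne_zero)
    simp only [map_mul, map_pow, map_ofNat] at h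
    rw [eq_ratCast, map_ratCast] at h
    exact h.symm
  have hsq : ι (delta W two_ne_zero) ^ 2 = ((W.Δ / 16 : ℚ) : ℂ) := by
    have h16' : (16 : ℂ) ≠ 0 := by norm_num
    push_cast
    rw [eq_div_iff h16', ← h16, mul_comm]
  have hq : W.Δ / 16 < 0 := div_neg_of_neg_of_pos hΔ (by norm_num)
  -- `ι (c • δ) = conj (ι δ) = -ι δ = ι (-δ)`
  apply ι.injective
  rw [hι, conj_eq_neg_of_sq_eq_ratCast_of_neg hsq hq, map_neg]

/-- **Helper W-Δ: complex conjugation is a TRANSPOSITION on `E[2]` when `Δ < 0`.** For an elliptic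
`W/ℚ` with `Δ < 0` and a complex conjugation `c ∈ Γ_ℚ`, the permutation of `{T₀, T₁, T₂}` induced by
`c` is odd: `sign (permGal c) = -1` (an odd permutation of three letters is a transposition; concretely,
the two complex-conjugate roots of the `2`-division cubic are swapped and the real one is fixed).
Proof: `c • δ = sign(permGal c) · δ` ("`ℚ(E[2]) ⊃ ℚ(√Δ)`") and `c • δ = -δ`
(`smul_delta_eq_neg_of_isComplexConjugation_of_Δ_neg`), with `δ ≠ 0` in characteristic `0`.
[cite: DokchitserDokchitserMathZ2012, Theorem (1)] -/
theorem sign_permGal_eq_neg_one_of_isComplexConjugation_of_Δ_neg (W : WeierstrassCurve ℚ) [W.IsElliptic]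
    {φ : ℚ →+* ℝ} {c : Field.absoluteGaloisGroup ℚ} (hc : IsComplexConjugation φ c) (hΔ : W.Δ < 0) :
    Equiv.Perm.sign (permGal W two_ne_zero c) = -1 := by
  rcases Int.units_eq_one_or (Equiv.Perm.sign (permGal W two_ne_zero c)) with h | h
  · exfalso
    have h1 := smul_delta W two_ne_zero c
    rw [smul_delta_eq_neg_of_isComplexConjugation_of_Δ_neg W hc hΔ, h, Units.val_one, Int.cast_one,
      one_mul, CharZero.neg_eq_self_iff] at h1
    exact delta_ne_zero W two_ne_zero h1
  · exact h

/-- **Helper W-Δ, consumer shape: complex conjugation moves some `2`-torsion point when `Δ < 0`.**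
`sign (permGal c) = -1 ≠ sign 1`, so `permGal c ≠ 1` moves some letter `i`, and then
`c • T_i = T_{permGal c i} ≠ T_i` (the `T_i` are distinct, Silverman III.6.4(b)).
[cite: SilvermanAEC2009, III.§7 (the representation G_{K̄/K} → Aut(E[m]))] -/
theorem exists_smul_ne_of_isComplexConjugation_of_Δ_neg (W : WeierstrassCurve ℚ) [W.IsElliptic]
    {φ : ℚ →+* ℝ} {c : Field.absoluteGaloisGroup ℚ} (hc : IsComplexConjugation φ c) (hΔ : W.Δ < 0) :
    ∃ P : WeierstrassCurve.geomTorsion W 2, c • P ≠ P := by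
  have hsign := sign_permGal_eq_neg_one_of_isComplexConjugation_of_Δ_neg W hc hΔ
  have hne : permGal W two_ne_zero c ≠ 1 := by
    intro h
    rw [h, Equiv.Perm.sign_one] at hsign
    exact absurd hsign (by decide)
  obtain ⟨i, hi⟩ : ∃ i : Fin 3, permGal W two_ne_zero c i ≠ i := by
    by_contra h
    exact hne (Equiv.ext fun i ↦ not_not.mp (not_exists.mp h i))
  exact ⟨T W two_ne_zero i, fun h ↦
    hi (T_injective W two_ne_zero ((T_permGal W two_ne_zero c i).trans h))⟩

end Summit.BirchSwinnertonDyer.BirchSwinnertonDyer.Theorems.SteinbergFibreAtTwo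

end
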